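import Literature.NumberTheory.EllipticCurves.ZpExtension
import Literature.NumberTheory.EllipticCurves.GeomPointsGaloisModule
import Literature.NumberTheory.GaloisRepresentations.GaloisCohomology
import HarnessLib

/-!
# The mod-`(p, T^J)` Iwasawa twist `M ⊗ 𝔽_p[T]/(T^J)(χ_κ)` of a `p`-torsion discrete Galois module
# along a `ℤ_p`-extension `κ` — the finite coefficient modules `𝒯_J` of Λ/p-adic Kolyvagin arguments
# (definitions with bodies + unfolding lemmas; no named fact)

Topic `NumberTheory/EllipticCurves` (next to `ZpExtension`, `IwasawaSelmer`); namespace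
`Literature.NumberTheory.EllipticCurves.ZpExtension` (dot notation `κ.twistModP ρ J`). DEFINITIONS WITH
BODIES AND THEOREMS ONLY — nothing is asserted (D-0026). Cell `bsd-smallim` (rung K6, class X9), seat
`bsd-smallim-k6-ty`: the OBJECT `𝒯_J := 𝕋/(p, T^J) = E[p] ⊗_{𝔽_p} 𝔽_p[T]/(T^J)(χ)` of
HOME/koly/MU-TRANSFER-PROOF.md §0 (`𝕋 = T_pE ⊗ Λ(χ_Λ)`, `Λ = ℤ_p⟦T⟧`, `T = γ − 1`, `χ_Λ : G_ℚ ↠ Γ ⊂ Λ^×`),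
in the COORDINATE MODEL of the kernel file `Theorems/SmallImageMuTransferMuTransferStubX9LevelE.lean`
(`𝒯_e ≅ V^e = Fin e → V`, the `i`-th coordinate = the coefficient of `T^i`, `T` = the shift), realised
as a genuine discrete `Γ_K`-module so that the tree's continuous cohomology (`galoisCohomology`,
`H1 T U`, localisation, Selmer structures, Poitou–Tate facts) applies to it.

Let `K` be a field, `p` a prime, `κ : ZpExtension K p` (`κ : Γ_K →ₜ* ℤ_p` surjective; `K_∞`, layers
`κ.layerSubgroup n = Gal(K̄/K_n)`), `ρ : DiscreteGaloisModule K M` with `M` killed by `p`, and `J : ℕ`.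

* `shiftEnd M J` — the shift `S` on `Fin J → M`: `(S x)_0 = 0`, `(S x)_i = x_{i−1}` (multiplication by
  `T` on `M ⊗ 𝔽_p[T]/(T^J)` in the basis `T^i`); `shiftEnd_pow_apply`, `shiftEnd_pow_eq_zero` (`S^J = 0`).
* `unipotentPow M J a = (1 + S)^a` (multiplication by `(1+T)^a = γ^a`); `unipotentPow_add`;
  `unipotentPow_prime_pow_eq_one` (`(1+S)^{p^m} = 1` once `J ≤ p^m`, from the binomial theorem and
  `p·M = 0` — in characteristic `p`, `(1+T)^{p^m} = 1 + T^{p^m}`); `unipotentPow_eq_one_of_dvd`.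
* `twistExponent κ J g = ((κ g) mod p^J).val ∈ ℕ` — a representative of `κ(g) ∈ ℤ_p` modulo `p^J`
  (enough, as `(1+S)^{p^J} = 1`); `twistExponent_one`, `unipotentPow_twistExponent_mul`.
* `twistModPRepresentation κ ρ J : Representation ℤ Γ_K (Fin J → M)`,
  `g ↦ (1+S)^{twistExponent g} ∘ (ρ g coordinatewise)` — i.e. `g` acts on `M ⊗ 𝔽_p[T]/T^J` by
  `ρ(g) ⊗ (1+T)^{κ(g)}`; and **`κ.twistModP ρ J : DiscreteGaloisModule K (Fin J → M)`** (continuity: the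
  stabiliser of `x` contains `⋂_i Stab_ρ(x_i) ∩ κ.layerSubgroup J`, a neighbourhood of `1`).
* Unfolding / structure lemmas: `twistModP_apply`; `shiftEnd_comm_twistModP` (`S` is `Γ_K`-equivariant,
  i.e. `𝒯_J` is a `𝔽_p[T]/T^J[Γ_K]`-module); `twistModP_apply_of_mem_layerSubgroup` (for `m ≤ J ≤ p^m`,
  `Gal(K̄/K_m)` acts through `ρ` alone — "`G_{L₀}` acts trivially on the twist part of `𝒯_e`",
  MU-TRANSFER-PROOF (F8) with `e = p^{m₀−1}`, `m = m₀ − 1`); `twistModP_apply_of_isTopGenerator`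
  (`γ` acts by `(1+S) ∘ ρ(γ)`: `T = γ − 1` is the shift on `ρ(γ)`-fixed coordinates).

* Equivariant coordinate maps (Mathlib `ContIntertwiningMap`s, ready for `galoisCohomology.map`):
  `twistModPConstCoeff` (`𝒯_J → M`, `x ↦ x_0`: reduction mod `T`, `𝒯_J/T𝒯_J ≅ M` — MU-TRANSFER-PROOF
  (F4) `𝒯/T𝒯 = E[p]`) and `twistModPTopCoeff` (`M → 𝒯_J`, `m ↦ m·T^{J−1}`: `M ≅ T^{J−1}𝒯_J = 𝒯_J[T]`),
  with `unipotentPow_apply_zero`, `shiftEnd_single_top`, `unipotentPow_single_top`.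

* Change of level (`J' ≤ J`), again as `ContIntertwiningMap`s: `twistModPTruncate` (`𝒯_J → 𝒯_{J'}`,
  `x ↦ x mod T^{J'}`) and `twistModPShiftEmbed` (`𝒯_{J'} → 𝒯_J`, `x ↦ T^{J−J'}x`, image `𝒯_J[T^{J'}]`),
  with `castLE_shiftEmbed` (the composite `𝒯_{J'} → 𝒯_J → 𝒯_{J'}` is `S^{J−J'}`).

* The elliptic-curve case `WeierstrassCurve.modPTwist W p κ J` (`M = E[p] = W.torsionGaloisModule p`,
  `p`-torsion by `AddSubgroup.torsionBy.nsmul`), with `modPTwist_apply(_of_isTopGenerator/_of_mem_layerSubgroup)`.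

Not here (next files of the typer): the Tate dual `𝒯_J^* ≅ M^*(1) ⊗ 𝔽_p[T]/T^J(χ^{-1})`
(MU-TRANSFER-PROOF (4.1)) and the dictionary `H¹(K, M ⊗ 𝔽_p[Γ_m]) = H¹(K_m, M)` (Shapiro).

References: B. Mazur, K. Rubin, *Kolyvagin systems*, Mem. AMS 799 (2004) §5.3 (the modules
`T ⊗ Λ/(𝔪^k)`) [MazurRubin2004]; K. Kato, Astérisque 295 (2004) §13.3 [Kato2004Asterisque]; L. Washington,
*Introduction to Cyclotomic Fields*, §13.1–13.2 (`Λ = ℤ_p⟦T⟧`, `T = γ − 1`) [Washington1997];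
HOME/koly/MU-TRANSFER-PROOF.md §0, (F5), (F8).
-/

noncomputable section

open scoped Topology ContRepresentation
open Field Filter

universe u

namespace Literature.NumberTheory.EllipticCurves

open Literature.NumberTheory.GaloisRepresentations

/-! ## The shift and the unipotent operators on `Fin J → M` -/

section Shift

variable (M : Type*) [AddCommGroup M] (J : ℕ)

/-- The **shift** `S` on `Fin J → M` (coordinates = coefficients of `1, T, …, T^{J−1}`):
`(S x)_0 = 0`, `(S x)_i = x_{i−1}` — multiplication by `T` on `M ⊗ ℤ[T]/(T^J)`.
Ref: Washington, *Introduction to Cyclotomic Fields*, §13.2 (`Λ/(T^J)`). [cite: Washington1997, §13.1–§13.2] -/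
def shiftEnd : Module.End ℤ (Fin J → M) where
  toFun x i := if h : (i : ℕ) = 0 then 0 else x ⟨(i : ℕ) - 1, by omega⟩
  map_add' x y := by
    funext i
    by_cases h : (i : ℕ) = 0 <;> simp [h]
  map_smul' c x := by
    funext i
    by_cases h : (i : ℕ) = 0 <;> simp [h]

variable {M J}

/-- Unfolding lemma for the shift. [cite: Washington1997, §13.1–§13.2] -/
theorem shiftEnd_apply (x : Fin J → M) (i : Fin J) :
    shiftEnd M J x i = if h : (i : ℕ) = 0 then 0 else x ⟨(i : ℕ) - 1, by omega⟩ := rfl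

/-- The `k`-th power of the shift: `(S^k x)_i = x_{i−k}` for `i ≥ k` and `0` for `i < k`
(multiplication by `T^k`). [cite: Washington1997, §13.1–§13.2] -/
theorem shiftEnd_pow_apply (k : ℕ) (x : Fin J → M) (i : Fin J) :
    (shiftEnd M J ^ k) x i = if h : (i : ℕ) < k then 0 else x ⟨(i : ℕ) - k, by omega⟩ := by
  induction k generalizing i with
  | zero => simp
  | succ k ih =>
    rw [pow_succ', Module.End.mul_apply, shiftEnd_apply]
    by_cases h0 : (i : ℕ) = 0
    · simp [h0]
    · rw [dif_neg h0, ih]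
      by_cases hk : (i : ℕ) - 1 < k
      · have : (i : ℕ) < k + 1 := by omega
        simp [hk, this]
      · have : ¬ (i : ℕ) < k + 1 := by omega
        simp only [hk, this, dite_false]
        congr 2
        omega

/-- `S^k = 0` as soon as `J ≤ k`; in particular `S^J = 0` (`T^J = 0` on `M ⊗ ℤ[T]/(T^J)`). [cite: Washington1997, §13.1–§13.2] -/
theorem shiftEnd_pow_eq_zero {k : ℕ} (hk : J ≤ k) : shiftEnd M J ^ k = 0 := by
  refine LinearMap.ext fun x => funext fun i => ?_
  rw [shiftEnd_pow_apply, LinearMap.zero_apply, Pi.zero_apply, dif_pos (lt_of_lt_of_le i.2 hk)]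

variable (M J)

/-- The **unipotent operator** `(1 + S)^a` on `Fin J → M` — multiplication by `(1+T)^a = γ^a` on
`M ⊗ ℤ[T]/(T^J)` with `T = γ − 1`. Ref: Washington, §13.2. [cite: Washington1997, §13.1–§13.2] -/
def unipotentPow (a : ℕ) : Module.End ℤ (Fin J → M) := (1 + shiftEnd M J) ^ a

variable {M J}

/-- `(1+S)^{a+b} = (1+S)^a (1+S)^b`. [cite: Washington1997, §13.1–§13.2] -/
theorem unipotentPow_add (a b : ℕ) :
    unipotentPow M J (a + b) = unipotentPow M J a * unipotentPow M J b := pow_add _ _ _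

/-- `(1+S)^0 = 1`. [cite: Washington1997, §13.1–§13.2] -/
@[simp] theorem unipotentPow_zero : unipotentPow M J 0 = 1 := pow_zero _

/-- The shift commutes with every unipotent operator. [cite: Washington1997, §13.1–§13.2] -/
theorem commute_shiftEnd_unipotentPow (a : ℕ) : Commute (shiftEnd M J) (unipotentPow M J a) :=
  ((Commute.one_right _).add_right (Commute.refl _)).pow_right a

/-- In a ring in which the prime `p` is `0`, `(1 + N)^{p^m} = 1 + N^{p^m}` ("freshman's dream",
proved from the binomial theorem and `p ∣ C(p^m, k)` for `0 < k < p^m`; no `CharP` instance is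
assumed, so the zero ring is allowed). [cite: Washington1997, §13.2 (arithmetic in Λ/(p, T^n))] -/
theorem one_add_pow_prime_pow_of_natCast_eq_zero {R : Type*} [Ring R] {p : ℕ} (hp : p.Prime)
    (hR : (p : R) = 0) (N : R) (m : ℕ) : (1 + N) ^ p ^ m = 1 + N ^ p ^ m := by
  have hcomm : Commute (1 : R) N := Commute.one_left N
  rw [hcomm.add_pow]
  -- all terms with `0 < k < p^m` vanish
  have hmid : ∀ k ∈ Finset.range (p ^ m + 1), k ≠ 0 → k ≠ p ^ m →
      (1 : R) ^ k * N ^ (p ^ m - k) * ((p ^ m).choose k : R) = 0 := by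
    intro k hk hk0 hkn
    obtain ⟨c, hc⟩ := hp.dvd_choose_pow hk0 hkn
    rw [hc, Nat.cast_mul, hR, zero_mul, mul_zero]
  have hn0 : p ^ m ≠ 0 := pow_ne_zero _ hp.ne_zero
  rw [Finset.sum_eq_add_of_mem (0 : ℕ) (p ^ m) (Finset.mem_range.2 (Nat.succ_pos _))
    (Finset.mem_range.2 (Nat.lt_succ_self _)) (Ne.symm hn0) ?_]
  · simp [add_comm]
  · intro k hk hne
    exact hmid k hk hne.1 hne.2

variable {p : ℕ} [Fact p.Prime]

/-- On a module killed by `p`, `(1 + S)^{p^m} = 1` as soon as `J ≤ p^m`: `(1+S)^{p^m} = 1 + S^{p^m}`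
(freshman's dream, `p = 0` in `End(Fin J → M)`) and `S^{p^m} = 0`.  This is `(1+T)^{p^m} = 1` in
`𝔽_p[T]/(T^J)`, i.e. `Gal(K̄/K_m)` acts trivially on the twist (MU-TRANSFER-PROOF (F5)/(F8)). [cite: Washington1997, §13.1–§13.2] -/
theorem unipotentPow_prime_pow_eq_one (hM : ∀ x : M, p • x = 0) {m : ℕ} (hJ : J ≤ p ^ m) :
    unipotentPow M J (p ^ m) = 1 := by
  have hR : ((p : ℕ) : Module.End ℤ (Fin J → M)) = 0 := by
    refine LinearMap.ext fun x => funext fun i => ?_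
    rw [Module.End.natCast_apply, LinearMap.zero_apply, Pi.smul_apply, Pi.zero_apply, hM]
  rw [unipotentPow, one_add_pow_prime_pow_of_natCast_eq_zero (Fact.out : p.Prime) hR,
    shiftEnd_pow_eq_zero hJ, add_zero]

/-- Hence `(1+S)^a = 1` whenever `p^m ∣ a` and `J ≤ p^m`. [cite: Washington1997, §13.1–§13.2] -/
theorem unipotentPow_eq_one_of_dvd (hM : ∀ x : M, p • x = 0) {m a : ℕ} (hJ : J ≤ p ^ m)
    (ha : p ^ m ∣ a) : unipotentPow M J a = 1 := by
  obtain ⟨c, rfl⟩ := ha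
  rw [unipotentPow, pow_mul, ← unipotentPow, unipotentPow_prime_pow_eq_one hM hJ, one_pow]

/-- Hence `(1+S)^a` only depends on `a` modulo `p^m` (`J ≤ p^m`). [cite: Washington1997, §13.1–§13.2] -/
theorem unipotentPow_mod (hM : ∀ x : M, p • x = 0) {m : ℕ} (hJ : J ≤ p ^ m) (a : ℕ) :
    unipotentPow M J (a % p ^ m) = unipotentPow M J a := by
  conv_rhs => rw [← Nat.div_add_mod a (p ^ m), unipotentPow_add,
    unipotentPow_eq_one_of_dvd hM hJ (dvd_mul_right _ _), one_mul]

end Shift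

/-! ## The twisted representation and its continuity -/

namespace ZpExtension

variable {K : Type u} [Field K] {p : ℕ} [Fact p.Prime] (κ : ZpExtension K p)

/-- The exponent of `g ∈ Γ_K` at level `J`: the canonical representative in `ℕ` of
`κ(g) mod p^J ∈ ℤ/p^J` (`PadicInt.toZModPow`).  Since `(1+S)^{p^J} = 1` on `Fin J → M` (`J ≤ p^J`),
`(1+S)^{twistExponent κ J g}` is multiplication by `(1+T)^{κ(g)} = γ^{κ(g)}`. [cite: Washington1997, §13.1–§13.2] -/
def twistExponent (J : ℕ) (g : absoluteGaloisGroup K) : ℕ :=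
  (PadicInt.toZModPow J (κ g).toAdd).val

/-- `twistExponent` of `1` is `0`. [cite: Washington1997, §13.1–§13.2] -/
@[simp] theorem twistExponent_one (J : ℕ) : κ.twistExponent J 1 = 0 := by
  simp [twistExponent]

/-- `twistExponent (g h) ≡ twistExponent g + twistExponent h (mod p^J)`. [cite: Washington1997, §13.1–§13.2] -/
theorem twistExponent_mul (J : ℕ) (g h : absoluteGaloisGroup K) :
    κ.twistExponent J (g * h) = (κ.twistExponent J g + κ.twistExponent J h) % p ^ J := by
  simp only [twistExponent, map_mul, toAdd_mul, map_add, ZMod.val_add]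

/-- `p^m ∣ twistExponent κ J g` for `g ∈ Gal(K̄/K_m)` and `m ≤ J` (compatibility of the reductions
`ℤ_p → ℤ/p^J → ℤ/p^m`, `PadicInt.zmod_cast_comp_toZModPow`). [cite: Washington1997, §13.1–§13.2] -/
theorem prime_pow_dvd_twistExponent {J m : ℕ} (hm : m ≤ J) {g : absoluteGaloisGroup K}
    (hg : g ∈ κ.layerSubgroup m) : p ^ m ∣ κ.twistExponent J g := by
  haveI : NeZero (p ^ J) := ⟨pow_ne_zero _ (Fact.out : p.Prime).ne_zero⟩
  rw [mem_layerSubgroup] at hg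
  have h1 : PadicInt.toZModPow m (κ g).toAdd = 0 := by
    rw [← RingHom.mem_ker, PadicInt.ker_toZModPow, Ideal.mem_span_singleton]
    exact hg
  have h2 : ZMod.castHom (pow_dvd_pow p hm) (ZMod (p ^ m)) (PadicInt.toZModPow J (κ g).toAdd) = 0 := by
    rw [← RingHom.comp_apply, PadicInt.zmod_cast_comp_toZModPow _ _ hm, h1]
  rw [ZMod.castHom_apply, ZMod.cast_eq_val] at h2
  exact (ZMod.natCast_eq_zero_iff _ _).mp h2

/-! ### The representation `g ↦ (1+S)^{κ(g)} ∘ ρ(g)` on `Fin J → M` -/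

variable {M : Type u} [AddCommGroup M] [TopologicalSpace M] [DiscreteTopology M]

omit [TopologicalSpace M] [DiscreteTopology M] in
/-- The shift commutes with every coordinatewise operator. [cite: Washington1997, §13.1–§13.2] -/
theorem shiftEnd_mul_compLeft {J : ℕ} (f : M →ₗ[ℤ] M) :
    shiftEnd M J * f.compLeft (Fin J) = f.compLeft (Fin J) * shiftEnd M J := by
  refine LinearMap.ext fun x => funext fun i => ?_
  simp only [Module.End.mul_apply, shiftEnd_apply, LinearMap.compLeft_apply, Function.comp_apply]
  by_cases h : (i : ℕ) = 0
  · simp [h]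
  · simp [h]

omit [TopologicalSpace M] [DiscreteTopology M] in
/-- Hence every unipotent operator commutes with every coordinatewise operator. [cite: Washington1997, §13.1–§13.2] -/
theorem unipotentPow_mul_compLeft {J : ℕ} (a : ℕ) (f : M →ₗ[ℤ] M) :
    unipotentPow M J a * f.compLeft (Fin J) = f.compLeft (Fin J) * unipotentPow M J a :=
  (((Commute.one_left _).add_left (shiftEnd_mul_compLeft f)).pow_left a).eq

omit [TopologicalSpace M] [DiscreteTopology M] in
/-- `compLeft` is multiplicative. [cite: Washington1997, §13.1–§13.2] -/
theorem compLeft_mul {J : ℕ} (f g : M →ₗ[ℤ] M) :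
    (f * g).compLeft (Fin J) = f.compLeft (Fin J) * g.compLeft (Fin J) :=
  LinearMap.ext fun _ => rfl

omit [TopologicalSpace M] [DiscreteTopology M] in
/-- `compLeft` of the identity is the identity. [cite: Washington1997, §13.1–§13.2] -/
theorem compLeft_one {J : ℕ} : (1 : M →ₗ[ℤ] M).compLeft (Fin J) = 1 :=
  LinearMap.ext fun _ => rfl

/-- The **mod-`(p, T^J)` Iwasawa twist as a representation**: `g ∈ Γ_K` acts on `Fin J → M`
(`= M ⊗ 𝔽_p[T]/(T^J)`) by `(1+S)^{κ(g)} ∘ ρ(g)`, i.e. by `ρ(g) ⊗ (1+T)^{κ(g)}` — the action of `Γ_K` on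
`M ⊗ Λ/(p, T^J)(χ_κ)` with `Λ = ℤ_p⟦T⟧`, `T = γ − 1`, `χ_κ(g) = γ^{κ(g)}`.  Well defined because `M` is
killed by `p` (so `(1+S)^{p^J} = 1` and the exponent matters only modulo `p^J`).
Ref: Mazur–Rubin, Mem. AMS 799 (2004) §5.3 (`T ⊗ Λ`); MU-TRANSFER-PROOF §0 (`𝒯 = E[p] ⊗ Ω(χ)`). [cite: Washington1997, §13.1–§13.2] -/
def twistModPRepresentation (ρ : DiscreteGaloisModule K M) (hM : ∀ x : M, p • x = 0) (J : ℕ) :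
    Representation ℤ (absoluteGaloisGroup K) (Fin J → M) where
  toFun g := unipotentPow M J (κ.twistExponent J g) * (ρ g).compLeft (Fin J)
  map_one' := by
    rw [twistExponent_one, unipotentPow_zero, one_mul, map_one, compLeft_one]
  map_mul' g h := by
    have hJ : J ≤ p ^ J := (Nat.lt_pow_self (Fact.out : p.Prime).one_lt).le
    rw [twistExponent_mul, unipotentPow_mod hM hJ, unipotentPow_add, map_mul, compLeft_mul,
      mul_assoc, ← mul_assoc (unipotentPow M J (κ.twistExponent J h)),
      unipotentPow_mul_compLeft, mul_assoc, mul_assoc]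

/-- Unfolding lemma for `twistModPRepresentation`. [cite: Washington1997, §13.1–§13.2] -/
theorem twistModPRepresentation_apply (ρ : DiscreteGaloisModule K M) (hM : ∀ x : M, p • x = 0)
    (J : ℕ) (g : absoluteGaloisGroup K) (x : Fin J → M) :
    κ.twistModPRepresentation ρ hM J g x =
      unipotentPow M J (κ.twistExponent J g) (fun i => ρ g (x i)) := rfl

/-- **`𝒯_J(ρ, κ) = M ⊗ 𝔽_p[T]/(T^J)(χ_κ)` as a DISCRETE `Γ_K`-MODULE** (`κ.twistModP ρ hM J`): the
representation `twistModPRepresentation` is continuous for the discrete topology on `Fin J → M`, the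
stabiliser of `x` containing `⋂_i Stab_ρ(x_i) ∩ Gal(K̄/K_J)` (`Gal(K̄/K_J) = κ.layerSubgroup J` acts
trivially on the twist since `(1+S)^{p^J} = 1`).  This is the object on which the tree's
`galoisCohomology`, `H1 T U`, localisation and Selmer structures are evaluated in Λ/p-adic
Kolyvagin arguments (MU-TRANSFER-PROOF §§0–5: `𝒯_J`, `J = e, 2e`).
Ref: Mazur–Rubin, Mem. AMS 799 (2004) §5.3; Kato, Astérisque 295 §13.3. [cite: Washington1997, §13.1–§13.2] -/
def twistModP (ρ : DiscreteGaloisModule K M) (hM : ∀ x : M, p • x = 0) (J : ℕ) :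
    DiscreteGaloisModule K (Fin J → M) :=
  ContinuousRep.ofStabilizerMemNhdsOne (κ.twistModPRepresentation ρ hM J) fun x => by
    have hJ : J ≤ p ^ J := (Nat.lt_pow_self (Fact.out : p.Prime).one_lt).le
    have h1 : (κ.layerSubgroup J : Set (absoluteGaloisGroup K)) ∈ 𝓝 (1 : absoluteGaloisGroup K) :=
      (κ.isOpen_layerSubgroup J).mem_nhds (one_mem _)
    have h2 : (⋂ i : Fin J, {σ : absoluteGaloisGroup K | ρ σ (x i) = x i}) ∈
        𝓝 (1 : absoluteGaloisGroup K) :=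
      (Filter.iInter_mem).2 fun i => ρ.setOf_apply_eq_mem_nhds_one (x i)
    filter_upwards [h1, h2] with σ hσ1 hσ2
    simp only [Set.mem_iInter, Set.mem_setOf_eq] at hσ2
    simp only [twistModPRepresentation_apply,
      unipotentPow_eq_one_of_dvd hM hJ (κ.prime_pow_dvd_twistExponent le_rfl hσ1),
      Module.End.one_apply]
    funext i
    exact hσ2 i

variable (ρ : DiscreteGaloisModule K M) (hM : ∀ x : M, p • x = 0) (J : ℕ)

/-- Unfolding lemma: `g` acts on `𝒯_J` by `(1+S)^{κ(g) mod p^J}` after `ρ(g)` coordinatewise. [cite: Washington1997, §13.1–§13.2] -/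
theorem twistModP_apply (g : absoluteGaloisGroup K) (x : Fin J → M) :
    κ.twistModP ρ hM J g x = unipotentPow M J (κ.twistExponent J g) (fun i => ρ g (x i)) := rfl

/-- **`S` (multiplication by `T`) is `Γ_K`-equivariant on `𝒯_J`**: `𝒯_J` is a module over
`𝔽_p[T]/(T^J)` with a `T`-linear Galois action. [cite: Washington1997, §13.1–§13.2] -/
theorem shiftEnd_twistModP_apply (g : absoluteGaloisGroup K) (x : Fin J → M) :
    shiftEnd M J (κ.twistModP ρ hM J g x) = κ.twistModP ρ hM J g (shiftEnd M J x) := by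
  change (shiftEnd M J * (unipotentPow M J (κ.twistExponent J g) * (ρ g).compLeft (Fin J))) x =
    (unipotentPow M J (κ.twistExponent J g) * (ρ g).compLeft (Fin J) * shiftEnd M J) x
  rw [← mul_assoc, (commute_shiftEnd_unipotentPow _).eq, mul_assoc, shiftEnd_mul_compLeft,
    mul_assoc]

/-- **`Gal(K̄/K_m)` acts on `𝒯_J` through `ρ` alone when `m ≤ J ≤ p^m`** (the twist character is
trivial on `κ.layerSubgroup m` modulo `T^J`: `(1+T)^{p^m} = 1` in `𝔽_p[T]/(T^J)`).  With
`J = e = p^{m₀−1}`, `m = m₀ − 1` this is "`G_{L₀}` acts trivially on `A_e(χ)`" of MU-TRANSFER-PROOF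
(F8). [cite: Washington1997, §13.1–§13.2] -/
theorem twistModP_apply_of_mem_layerSubgroup {m : ℕ} (hm : m ≤ J) (hJ : J ≤ p ^ m)
    {g : absoluteGaloisGroup K} (hg : g ∈ κ.layerSubgroup m) (x : Fin J → M) :
    κ.twistModP ρ hM J g x = fun i => ρ g (x i) := by
  rw [twistModP_apply, unipotentPow_eq_one_of_dvd hM hJ (κ.prime_pow_dvd_twistExponent hm hg),
    Module.End.one_apply]

/-- **A topological generator `γ` (`κ γ = 1`) acts on `𝒯_J` by `(1 + S) ∘ ρ(γ)`**: on `ρ(γ)`-fixed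
coordinates, `T = γ − 1` IS the shift (Washington §13.2, `T = γ − 1`). [cite: Washington1997, §13.1–§13.2] -/
theorem twistModP_apply_of_isTopGenerator {γ : absoluteGaloisGroup K} (hγ : κ.IsTopGenerator γ)
    (x : Fin J → M) :
    κ.twistModP ρ hM J γ x = (1 + shiftEnd M J) (fun i => ρ γ (x i)) := by
  rcases Nat.eq_zero_or_pos J with rfl | hJ
  · exact Subsingleton.elim _ _
  · haveI : Fact (1 < p ^ J) := ⟨Nat.one_lt_pow hJ.ne' (Fact.out : p.Prime).one_lt⟩
    have hexp : κ.twistExponent J γ = 1 := by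
      rw [twistExponent, show κ γ = Multiplicative.ofAdd 1 from hγ, toAdd_ofAdd, map_one, ZMod.val_one]
    rw [twistModP_apply, hexp, unipotentPow, pow_one]

/-- On `𝒯_J`, `γ − 1` acts as the shift composed with `ρ(γ)`:
`γ•x − ρ(γ)x = S(ρ(γ) x)` (so `T = γ − 1` on the `ρ(γ)`-invariant part). [cite: Washington1997, §13.1–§13.2] -/
theorem twistModP_apply_sub_of_isTopGenerator {γ : absoluteGaloisGroup K} (hγ : κ.IsTopGenerator γ)
    (x : Fin J → M) :
    κ.twistModP ρ hM J γ x - (fun i => ρ γ (x i)) = shiftEnd M J (fun i => ρ γ (x i)) := by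
  rw [twistModP_apply_of_isTopGenerator κ ρ hM J hγ, LinearMap.add_apply, Module.End.one_apply,
    add_sub_cancel_left]


/-! ### Equivariant coordinate maps: `𝒯_J → M` (constant coefficient) and `M → 𝒯_J` (top coefficient) -/

omit [TopologicalSpace M] [DiscreteTopology M] in
/-- The unipotent operators do not change the constant coefficient: `((1+S)^a y)_0 = y_0`.
[cite: Washington1997, §13.1–§13.2] -/
theorem unipotentPow_apply_zero {J : ℕ} (hJ : 0 < J) (a : ℕ) (y : Fin J → M) :
    unipotentPow M J a y ⟨0, hJ⟩ = y ⟨0, hJ⟩ := by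
  induction a with
  | zero => simp
  | succ a ih =>
    rw [unipotentPow, pow_succ', Module.End.mul_apply, ← unipotentPow, LinearMap.add_apply,
      Module.End.one_apply, Pi.add_apply, ih, shiftEnd_apply, dif_pos rfl, add_zero]

omit [TopologicalSpace M] [DiscreteTopology M] in
/-- The unipotent operators do not change the top coefficient of a vector supported in the top
coordinate: for `y` with `y_i = 0` (`i < J − 1`), `((1+S)^a y)_{J−1} = y_{J−1}` — indeed `S y = 0`.
[cite: Washington1997, §13.1–§13.2] -/
theorem shiftEnd_single_top {J : ℕ} (hJ : 0 < J) (m : M) :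
    shiftEnd M J (Pi.single (⟨J - 1, Nat.sub_lt hJ Nat.one_pos⟩ : Fin J) m) = 0 := by
  funext i
  rw [shiftEnd_apply, Pi.zero_apply]
  by_cases h : (i : ℕ) = 0
  · rw [dif_pos h]
  · rw [dif_neg h, Pi.single_apply, if_neg]
    intro hi
    have := congrArg Fin.val hi
    simp only at this
    omega

omit [TopologicalSpace M] [DiscreteTopology M] in
/-- Hence `(1+S)^a` fixes the vectors supported in the top coordinate. [cite: Washington1997, §13.1–§13.2] -/
theorem unipotentPow_single_top {J : ℕ} (hJ : 0 < J) (a : ℕ) (m : M) :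
    unipotentPow M J a (Pi.single (⟨J - 1, Nat.sub_lt hJ Nat.one_pos⟩ : Fin J) m) =
      Pi.single (⟨J - 1, Nat.sub_lt hJ Nat.one_pos⟩ : Fin J) m := by
  induction a with
  | zero => simp
  | succ a ih =>
    rw [unipotentPow, pow_succ', Module.End.mul_apply, ← unipotentPow, ih, LinearMap.add_apply,
      Module.End.one_apply, shiftEnd_single_top hJ, add_zero]

/-- **The constant-coefficient map `𝒯_J → M`, `x ↦ x_0` (reduction modulo `T`), is `Γ_K`-equivariant**
(`(g•x)_0 = ρ(g) x_0`): `𝒯_J/T𝒯_J ≅ M` as Galois modules (MU-TRANSFER-PROOF (F4): `𝒯/T𝒯 = E[p]`).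
A continuous intertwining map (Mathlib `ContIntertwiningMap`), usable in `galoisCohomology.map`.
[cite: Washington1997, §13.1–§13.2] -/
def twistModPConstCoeff (hJ : 0 < J) :
    (κ.twistModP ρ hM J).toContRepresentation →ⁱL ρ.toContRepresentation where
  toContinuousLinearMap :=
    { toFun := fun x => x ⟨0, hJ⟩
      map_add' := fun _ _ => rfl
      map_smul' := fun _ _ => rfl
      cont := continuous_of_discreteTopology }
  isIntertwining' g := by
    refine ContinuousLinearMap.ext fun x => ?_
    change (κ.twistModP ρ hM J g x) ⟨0, hJ⟩ = ρ g (x ⟨0, hJ⟩)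
    rw [twistModP_apply, unipotentPow_apply_zero]

/-- Unfolding lemma for `twistModPConstCoeff`. [cite: Washington1997, §13.1–§13.2] -/
@[simp] theorem twistModPConstCoeff_apply (hJ : 0 < J) (x : Fin J → M) :
    κ.twistModPConstCoeff ρ hM J hJ x = x ⟨0, hJ⟩ := rfl

/-- **The top-coefficient inclusion `M → 𝒯_J`, `m ↦ m·T^{J−1}`, is `Γ_K`-equivariant**
(`g•(m T^{J−1}) = (ρ(g)m) T^{J−1}` since `T^J = 0`): `M ≅ T^{J−1}𝒯_J = 𝒯_J[T]` as Galois modules.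
[cite: Washington1997, §13.1–§13.2] -/
def twistModPTopCoeff (hJ : 0 < J) :
    ρ.toContRepresentation →ⁱL (κ.twistModP ρ hM J).toContRepresentation where
  toContinuousLinearMap :=
    { toFun := fun m => Pi.single (⟨J - 1, Nat.sub_lt hJ Nat.one_pos⟩ : Fin J) m
      map_add' := fun a b => by
        funext i
        simp only [Pi.add_apply, Pi.single_apply]
        split_ifs <;> simp
      map_smul' := fun c a => by
        funext i
        simp only [Pi.smul_apply, Pi.single_apply, RingHom.id_apply]
        split_ifs <;> simp
      cont := continuous_of_discreteTopology }
  isIntertwining' g := by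
    refine ContinuousLinearMap.ext fun m => ?_
    change Pi.single _ (ρ g m) = κ.twistModP ρ hM J g (Pi.single _ m)
    have : (fun i => ρ g ((Pi.single (⟨J - 1, Nat.sub_lt hJ Nat.one_pos⟩ : Fin J) m :
        Fin J → M) i)) = Pi.single (⟨J - 1, Nat.sub_lt hJ Nat.one_pos⟩ : Fin J) (ρ g m) := by
      funext i
      simp only [Pi.single_apply]
      split_ifs <;> simp
    rw [twistModP_apply, this, unipotentPow_single_top hJ]

/-- Unfolding lemma for `twistModPTopCoeff`. [cite: Washington1997, §13.1–§13.2] -/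
@[simp] theorem twistModPTopCoeff_apply (hJ : 0 < J) (m : M) :
    κ.twistModPTopCoeff ρ hM J hJ m = Pi.single (⟨J - 1, Nat.sub_lt hJ Nat.one_pos⟩ : Fin J) m :=
  rfl


/-! ### Truncation `𝒯_J → 𝒯_{J'}` and the `T^{J−J'}`-embedding `𝒯_{J'} → 𝒯_J` (`J' ≤ J`) -/

section ChangeLevel

variable {J' : ℕ} (hJ' : J' ≤ J)

/-- The exponents at levels `J' ≤ J` are compatible: `twistExponent J g ≡ twistExponent J' g (mod p^{J'})`
(`ℤ_p → ℤ/p^J → ℤ/p^{J'}`, `PadicInt.zmod_cast_comp_toZModPow`). [cite: Washington1997, §13.1–§13.2] -/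
theorem twistExponent_mod_pow (hJ' : J' ≤ J) (g : absoluteGaloisGroup K) :
    κ.twistExponent J g % p ^ J' = κ.twistExponent J' g := by
  haveI : NeZero (p ^ J) := ⟨pow_ne_zero _ (Fact.out : p.Prime).ne_zero⟩
  have h := congrArg (fun f : ℤ_[p] →+* ZMod (p ^ J') => (f (κ g).toAdd).val)
    (PadicInt.zmod_cast_comp_toZModPow J' J hJ')
  simp only [RingHom.comp_apply, ZMod.castHom_apply, ZMod.cast_eq_val, ZMod.val_natCast] at h
  exact h

omit [TopologicalSpace M] [DiscreteTopology M] in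
/-- Hence the level-`J'` unipotent operator may be computed with the level-`J` exponent.
[cite: Washington1997, §13.1–§13.2] -/
theorem unipotentPow_twistExponent_of_le (hM : ∀ x : M, p • x = 0) (hJ' : J' ≤ J)
    (g : absoluteGaloisGroup K) :
    unipotentPow M J' (κ.twistExponent J g) = unipotentPow M J' (κ.twistExponent J' g) := by
  rw [← twistExponent_mod_pow κ J hJ',
    unipotentPow_mod hM (Nat.lt_pow_self (Fact.out : p.Prime).one_lt).le]

omit [TopologicalSpace M] [DiscreteTopology M] in
/-- Truncation `x ↦ (x_0, …, x_{J'−1})` commutes with the shifts. [cite: Washington1997, §13.1–§13.2] -/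
theorem shiftEnd_comp_castLE (x : Fin J → M) :
    (fun i : Fin J' => shiftEnd M J x (Fin.castLE hJ' i)) =
      shiftEnd M J' (fun i => x (Fin.castLE hJ' i)) := by
  funext i
  simp only [shiftEnd_apply, Fin.val_castLE]
  by_cases h : (i : ℕ) = 0
  · rw [dif_pos h, dif_pos h]
  · rw [dif_neg h, dif_neg h]
    rfl

omit [TopologicalSpace M] [DiscreteTopology M] in
/-- One step of the unipotent recursion: `(1+S)^{a+1} y = (1+S)^a y + S((1+S)^a y)`.
[cite: Washington1997, §13.1–§13.2] -/
theorem unipotentPow_succ_apply {J : ℕ} (a : ℕ) (y : Fin J → M) :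
    unipotentPow M J (a + 1) y = unipotentPow M J a y + shiftEnd M J (unipotentPow M J a y) := by
  rw [unipotentPow, pow_succ', Module.End.mul_apply, LinearMap.add_apply, Module.End.one_apply]
  rfl

omit [TopologicalSpace M] [DiscreteTopology M] in
/-- Truncation commutes with the unipotent operators. [cite: Washington1997, §13.1–§13.2] -/
theorem unipotentPow_comp_castLE (a : ℕ) (x : Fin J → M) :
    (fun i : Fin J' => unipotentPow M J a x (Fin.castLE hJ' i)) =
      unipotentPow M J' a (fun i => x (Fin.castLE hJ' i)) := by
  induction a generalizing x with
  | zero => simp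
  | succ a ih =>
    rw [unipotentPow_succ_apply, unipotentPow_succ_apply, ← ih, ← shiftEnd_comp_castLE]
    rfl

/-- **Truncation `𝒯_J → 𝒯_{J'}` (`J' ≤ J`), `x ↦ x mod T^{J'}`, is `Γ_K`-equivariant** — the reduction
`M ⊗ 𝔽_p[T]/(T^J) → M ⊗ 𝔽_p[T]/(T^{J'})` (e.g. `𝒯_{2e} → 𝒯_e`, `κ' ↦ κ'_e` in MU-TRANSFER-PROOF §5
Step 1). A continuous intertwining map. [cite: Washington1997, §13.1–§13.2] -/
def twistModPTruncate :
    (κ.twistModP ρ hM J).toContRepresentation →ⁱL (κ.twistModP ρ hM J').toContRepresentation where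
  toContinuousLinearMap :=
    { toFun := fun x i => x (Fin.castLE hJ' i)
      map_add' := fun _ _ => rfl
      map_smul' := fun _ _ => rfl
      cont := continuous_of_discreteTopology }
  isIntertwining' g := by
    refine ContinuousLinearMap.ext fun x => ?_
    change (fun i => κ.twistModP ρ hM J g x (Fin.castLE hJ' i)) =
      κ.twistModP ρ hM J' g (fun i => x (Fin.castLE hJ' i))
    rw [twistModP_apply, twistModP_apply, ← unipotentPow_twistExponent_of_le κ J hM hJ']
    exact unipotentPow_comp_castLE J hJ' _ _

/-- Unfolding lemma for `twistModPTruncate`. [cite: Washington1997, §13.1–§13.2] -/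
@[simp] theorem twistModPTruncate_apply (x : Fin J → M) (i : Fin J') :
    κ.twistModPTruncate ρ hM J hJ' x i = x (Fin.castLE hJ' i) := rfl

/-- The `T^{J−J'}`-embedding on coordinates: `x ↦ T^{J−J'}·x`, i.e. `(embed x)_i = x_{i−(J−J')}` for
`i ≥ J − J'` and `0` below. [cite: Washington1997, §13.1–§13.2] -/
def shiftEmbed (x : Fin J' → M) : Fin J → M := fun i =>
  if h : J - J' ≤ (i : ℕ) then x ⟨(i : ℕ) - (J - J'), by omega⟩ else 0

omit [TopologicalSpace M] [DiscreteTopology M] in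
/-- Unfolding lemma for `shiftEmbed`. [cite: Washington1997, §13.1–§13.2] -/
theorem shiftEmbed_apply (x : Fin J' → M) (i : Fin J) :
    shiftEmbed J hJ' x i = if h : J - J' ≤ (i : ℕ) then x ⟨(i : ℕ) - (J - J'), by omega⟩ else 0 :=
  rfl

omit [TopologicalSpace M] [DiscreteTopology M] in
/-- `shiftEmbed` is additive. [cite: Washington1997, §13.1–§13.2] -/
theorem shiftEmbed_add (x y : Fin J' → M) :
    shiftEmbed J hJ' (x + y) = shiftEmbed J hJ' x + shiftEmbed J hJ' y := by
  funext i
  simp only [shiftEmbed_apply, Pi.add_apply]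
  split_ifs <;> simp

omit [TopologicalSpace M] [DiscreteTopology M] in
/-- The `T^{J−J'}`-embedding commutes with the shifts. [cite: Washington1997, §13.1–§13.2] -/
theorem shiftEnd_shiftEmbed (x : Fin J' → M) :
    shiftEnd M J (shiftEmbed J hJ' x) = shiftEmbed J hJ' (shiftEnd M J' x) := by
  funext i
  simp only [shiftEnd_apply, shiftEmbed_apply]
  split_ifs
  all_goals try dsimp only at *
  all_goals first
    | rfl
    | (exfalso; omega)
    | (congr 1; simp only [Fin.mk.injEq]; omega)

omit [TopologicalSpace M] [DiscreteTopology M] in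
/-- The `T^{J−J'}`-embedding commutes with the unipotent operators. [cite: Washington1997, §13.1–§13.2] -/
theorem unipotentPow_shiftEmbed (a : ℕ) (x : Fin J' → M) :
    unipotentPow M J a (shiftEmbed J hJ' x) = shiftEmbed J hJ' (unipotentPow M J' a x) := by
  induction a generalizing x with
  | zero => simp
  | succ a ih =>
    rw [unipotentPow_succ_apply, unipotentPow_succ_apply, ih, shiftEnd_shiftEmbed, shiftEmbed_add]

/-- **The `T^{J−J'}`-embedding `𝒯_{J'} → 𝒯_J`, `x ↦ T^{J−J'}x`, is `Γ_K`-equivariant** (its image is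
`T^{J−J'}𝒯_J = 𝒯_J[T^{J'}]`; e.g. `T^e : 𝒯_e ⥲ T^e𝒯_{2e}` in MU-TRANSFER-PROOF Lemma 1 (ii)/Lemma 2).
A continuous intertwining map. [cite: Washington1997, §13.1–§13.2] -/
def twistModPShiftEmbed :
    (κ.twistModP ρ hM J').toContRepresentation →ⁱL (κ.twistModP ρ hM J).toContRepresentation where
  toContinuousLinearMap :=
    { toFun := shiftEmbed J hJ'
      map_add' := shiftEmbed_add J hJ'
      map_smul' := fun c x => by
        funext i
        simp only [shiftEmbed_apply, Pi.smul_apply, RingHom.id_apply]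
        split_ifs <;> simp
      cont := continuous_of_discreteTopology }
  isIntertwining' g := by
    refine ContinuousLinearMap.ext fun x => ?_
    change shiftEmbed J hJ' (κ.twistModP ρ hM J' g x) = κ.twistModP ρ hM J g (shiftEmbed J hJ' x)
    have hdiag : (fun i => ρ g (shiftEmbed J hJ' x i)) = shiftEmbed J hJ' (fun i => ρ g (x i)) := by
      funext i
      simp only [shiftEmbed_apply]
      split_ifs <;> simp
    rw [twistModP_apply, twistModP_apply, hdiag, unipotentPow_shiftEmbed,
      unipotentPow_twistExponent_of_le κ J hM hJ']

/-- Unfolding lemma for `twistModPShiftEmbed`. [cite: Washington1997, §13.1–§13.2] -/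
@[simp] theorem twistModPShiftEmbed_apply (x : Fin J' → M) :
    κ.twistModPShiftEmbed ρ hM J hJ' x = shiftEmbed J hJ' x := rfl

omit [TopologicalSpace M] [DiscreteTopology M] in
/-- The composite `𝒯_{J'} → 𝒯_J → 𝒯_{J'}` (embed by `T^{J−J'}`, then truncate) is `S^{J−J'}`,
multiplication by `T^{J−J'}` on `𝒯_{J'}` (zero when `2J' ≤ J`). [cite: Washington1997, §13.1–§13.2] -/
theorem castLE_shiftEmbed (x : Fin J' → M) :
    (fun i : Fin J' => shiftEmbed J hJ' x (Fin.castLE hJ' i)) = (shiftEnd M J' ^ (J - J')) x := by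
  funext i
  simp only [shiftEmbed_apply, shiftEnd_pow_apply, Fin.val_castLE]
  by_cases h : J - J' ≤ (i : ℕ)
  · rw [dif_pos h, dif_neg (not_lt.mpr h)]
  · rw [dif_neg h, dif_pos (not_le.mp h)]

end ChangeLevel

end ZpExtension

end Literature.NumberTheory.EllipticCurves

/-! ## The case of an elliptic curve: `𝒯_J(E, p, κ) = E[p] ⊗ 𝔽_p[T]/(T^J)(χ_κ)` -/

namespace WeierstrassCurve

open Literature.NumberTheory.EllipticCurves Literature.NumberTheory.GaloisRepresentations

variable {F : Type u} [Field F] (W : WeierstrassCurve F) (p : ℕ) [Fact p.Prime]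
  (κ : ZpExtension F p) (J : ℕ)

/-- **`𝒯_J(E) := E[p] ⊗ 𝔽_p[T]/(T^J)(χ_κ)`** for a Weierstrass curve `W` over a field `F`, a prime `p`
and a `ℤ_p`-extension `κ` of `F`: the mod-`(p, T^J)` Iwasawa twist (`ZpExtension.twistModP`) of the
discrete Galois module `E[p] = W.torsionGaloisModule p` (file `GeomPointsGaloisModule`), on
`Fin J → E[p]`.  For `F = ℚ`, `κ` cyclotomic and `J ∈ {e, 2e}` these are the modules `𝒯_e`, `𝒯_J`
of HOME/koly/MU-TRANSFER-PROOF.md (§0: `𝒯 = 𝕋/p = E[p] ⊗ Ω(χ)`, `𝒯_J = 𝒯/T^J𝒯`), on which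
`galoisCohomology`, localisation, Selmer structures and the Poitou–Tate facts are evaluated.
[cite: Washington1997, §13.1–§13.2] -/
def modPTwist : DiscreteGaloisModule F (Fin J → geomTorsion W (p : ℤ)) :=
  κ.twistModP (W.torsionGaloisModule (p : ℤ)) (fun P => AddSubgroup.torsionBy.nsmul P) J

/-- Unfolding lemma: on `𝒯_J(E)`, `σ ∈ Γ_F` acts by `(1+S)^{κ(σ) mod p^J}` after `σ` coordinatewise on
`E[p]`. [cite: Washington1997, §13.1–§13.2] -/
theorem modPTwist_apply (σ : absoluteGaloisGroup F) (x : Fin J → geomTorsion W (p : ℤ)) :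
    W.modPTwist p κ J σ x = unipotentPow (geomTorsion W (p : ℤ)) J (κ.twistExponent J σ)
      (fun i => σ • x i) := rfl

/-- On `𝒯_J(E)`, a topological generator `γ` of `κ` acts by `(1+S) ∘ γ`: `T = γ − 1`.
[cite: Washington1997, §13.1–§13.2] -/
theorem modPTwist_apply_of_isTopGenerator {γ : absoluteGaloisGroup F} (hγ : κ.IsTopGenerator γ)
    (x : Fin J → geomTorsion W (p : ℤ)) :
    W.modPTwist p κ J γ x = (1 + shiftEnd (geomTorsion W (p : ℤ)) J) (fun i => γ • x i) :=
  ZpExtension.twistModP_apply_of_isTopGenerator κ _ _ J hγ x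

/-- On `𝒯_J(E)`, `Gal(F̄/F_m)` (`κ.layerSubgroup m`) acts through `E[p]` alone when `m ≤ J ≤ p^m`
(MU-TRANSFER-PROOF (F8): `G_{L₀}` acts trivially on `𝒯_e` once it acts trivially on `E[p]`,
`e = p^{m₀−1}`, `m = m₀ − 1`). [cite: Washington1997, §13.1–§13.2] -/
theorem modPTwist_apply_of_mem_layerSubgroup {m : ℕ} (hm : m ≤ J) (hJ : J ≤ p ^ m)
    {σ : absoluteGaloisGroup F} (hσ : σ ∈ κ.layerSubgroup m) (x : Fin J → geomTorsion W (p : ℤ)) :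
    W.modPTwist p κ J σ x = fun i => σ • x i :=
  ZpExtension.twistModP_apply_of_mem_layerSubgroup κ _ _ J hm hJ hσ x

end WeierstrassCurve

end
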